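import Summits.KontsevichZagierPeriods.KontsevichZagierPeriods.Theorems.GammaHodgeSector.Negative.LoadBearing
import Literature.Analysis.SpecialFunctions.GammaMultiplication
import Mathlib.Probability.Distributions.Beta

/-!
# `GammaHodgeSector` (stmt-KontsevichZagierPeriods-3742) — the multiplication pair is a Hodge pair

Arithmetic half of the containment `GammaHodgeSector ⊇ MultiplicationAccessible` (file
`…GammaHodgeSectorMultiplicationNecessary.lean`). For `m ≥ 1`, `n = m + 1` and a rational `s > 0`
consider the exponent data of the pure-Beta Gauss multiplication formula,
`(x, y) = ((i+1)/n, s)_{i<m}` (box side of `MultiplicationAccessible`, stmt-12305) versus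
`(x', y') = (s, (j+1)s)_{j<m}` (its simplex side peeled onto Beta factors). We prove:

* `sum_fract_div_add` — HERMITE'S IDENTITY for fractional parts,
  `Σ_{k<n} {k/n + v} = {nv} + (n−1)/2`, with the two re-indexings of sums over `ℤ/n` it needs
  (`sum_comp_mul_mod_eq` by a unit, `sum_comp_add_mod_eq` by a translation);
* `hodgeCondition_mult` — the pair passes the crux's HODGE TEST with `k = 0`: for every `u ≥ 1`
  coprime to the denominators both Koblitz–Ogus sums equal `(m+1){us} − {(m+1)us}` (the simplex
  side telescopes; the box side is re-indexed by the unit `u` of `ℤ/n` and summed by Hermite);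
* `admissible_multL`, `admissible_multR` — the data are admissible (positive, non-integral) as soon
  as `s ∉ ℤ`, resp. `m < den s`;
* `prod_beta_mult` — the pair's DELIGNE IDENTITY `∏_{i<m} B((i+1)/n, s) = n^{ns−1} ∏_{j<m} B(s, (j+1)s)`,
  i.e. Gauss's multiplication formula in Beta form, from the tree's
  `GaussMultiplication.real_formula` / `const_eq` (both sides are `n^{ns−1} Γ(s)^n / Γ(ns)`).

Everything is proved; no definitions, no named facts. References: Deligne, LNM 900 §7 (before
Thm 7.18); Andrews–Askey–Roy 1999, Thm 1.5.2.
-/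

noncomputable section

open MeasureTheory Set
open scoped BigOperators

namespace Summit.KontsevichZagierPeriods.GammaHodgeSectorKO

open Summit.KontsevichZagierPeriods.GammaHodgeSectorNegative (Admissible CoprimeDen hodgeSum
  HodgeCondition)
open Literature.Analysis.SpecialFunctions.GaussMultiplication (prodGamma real_formula const_eq)

/-! ## §1 Hermite's identity for fractional parts and two re-indexings mod `m + 1` -/

/-- Re-indexing a sum over `ℤ/(m+1)` by a unit: for `u` coprime to `m + 1` and any `g`,
`Σ_{k<m+1} g(u k mod (m+1)) = Σ_{k<m+1} g(k)`. [folklore] -/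
theorem sum_comp_mul_mod_eq (m u : ℕ) (hu : Nat.Coprime u (m + 1)) (g : ℕ → ℚ) :
    ∑ k : Fin (m + 1), g (u * (k : ℕ) % (m + 1)) = ∑ k : Fin (m + 1), g (k : ℕ) := by
  set U : (ZMod (m + 1))ˣ := ZMod.unitOfCoprime u hu with hU
  have h := Equiv.sum_comp (Units.mulLeft U) (fun x : ZMod (m + 1) => g x.val)
  have hval : ∀ x : ZMod (m + 1), (Units.mulLeft U x).val = u * x.val % (m + 1) := fun x => by
    rw [Units.mulLeft_apply, hU, ZMod.coe_unitOfCoprime, ZMod.val_mul, ZMod.val_natCast,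
      Nat.mod_mul_mod]
  simp only [hval] at h
  exact h

/-- Re-indexing a sum over `ℤ/(m+1)` by a translation: `Σ_{k<m+1} g((k + M) mod (m+1)) = Σ g(k)`.
[folklore] -/
theorem sum_comp_add_mod_eq (m M : ℕ) (g : ℕ → ℚ) :
    ∑ k : Fin (m + 1), g (((k : ℕ) + M) % (m + 1)) = ∑ k : Fin (m + 1), g (k : ℕ) := by
  have h := Equiv.sum_comp (Equiv.addRight (M : ZMod (m + 1))) (fun x : ZMod (m + 1) => g x.val)
  have hval : ∀ x : ZMod (m + 1), (Equiv.addRight (M : ZMod (m + 1)) x).val = (x.val + M) % (m + 1) :=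
    fun x => by rw [Equiv.coe_addRight, ZMod.val_add, ZMod.val_natCast, Nat.add_mod_mod]
  simp only [hval] at h
  exact h

/-- `Σ_{k<m+1} k = m(m+1)/2` in `ℚ`. [folklore] -/
theorem sum_fin_natCast (m : ℕ) : ∑ k : Fin (m + 1), ((k : ℕ) : ℚ) = (m : ℚ) * ((m : ℚ) + 1) / 2 := by
  rw [Fin.sum_univ_eq_sum_range (fun k => ((k : ℕ) : ℚ)) (m + 1)]
  induction m with
  | zero => simp
  | succ m ih =>
    rw [Finset.sum_range_succ, ih]
    push_cast
    ring

/-- `fract (a + b) = fract (fract a + b)`. [folklore] -/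
theorem fract_add_eq_fract_fract_add (a b : ℚ) : Int.fract (a + b) = Int.fract (Int.fract a + b) := by
  conv_lhs => rw [← Int.floor_add_fract a, add_assoc, add_comm, Int.fract_add_intCast]

/-- **Hermite's identity for fractional parts**: `Σ_{k<m+1} {k/(m+1) + v} = {(m+1)v} + m/2`.
[folklore] -/
theorem sum_fract_div_add (m : ℕ) (v : ℚ) :
    ∑ k : Fin (m + 1), Int.fract (((k : ℕ) : ℚ) / ((m : ℚ) + 1) + v) =
      Int.fract (((m : ℚ) + 1) * v) + (m : ℚ) / 2 := by
  set n : ℕ := m + 1 with hn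
  have hnq : ((m : ℚ) + 1) = (n : ℚ) := by rw [hn]; push_cast; ring
  have hnpos : (0 : ℚ) < n := by rw [hn]; positivity
  set w : ℚ := Int.fract v with hw
  have hw0 : 0 ≤ w := Int.fract_nonneg v
  -- `n w = M + θ`
  set M : ℕ := ⌊(n : ℚ) * w⌋.toNat with hM
  set θ : ℚ := Int.fract ((n : ℚ) * w) with hθ
  have hθ0 : 0 ≤ θ := Int.fract_nonneg _
  have hθ1 : θ < 1 := Int.fract_lt_one _
  have hMfloor : ((M : ℤ)) = ⌊(n : ℚ) * w⌋ := by
    rw [hM, Int.toNat_of_nonneg (Int.floor_nonneg.mpr (by positivity))]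
  have hnw : (n : ℚ) * w = (M : ℚ) + θ := by
    have h1 := Int.floor_add_fract ((n : ℚ) * w)
    rw [← hMfloor] at h1
    push_cast at h1
    rw [hθ]
    linarith
  have hvw : v = w + ⌊v⌋ := by rw [hw, Int.fract, sub_add_cancel]
  -- each term
  have hterm : ∀ k : ℕ, Int.fract ((k : ℚ) / ((m : ℚ) + 1) + v) =
      ((((k + M) % n : ℕ) : ℚ) + θ) / n := by
    intro k
    rw [hnq]
    have hkM : ((k : ℚ) + (M : ℚ)) = (n : ℚ) * (((k + M) / n : ℕ) : ℚ) + (((k + M) % n : ℕ) : ℚ) := by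
      exact_mod_cast (Nat.div_add_mod (k + M) n).symm
    have hlt : ((k + M) % n : ℕ) < n := Nat.mod_lt _ (by rw [hn]; omega)
    have hlt' : (((k + M) % n : ℕ) : ℚ) + θ < n := by
      have : (((k + M) % n : ℕ) : ℚ) + 1 ≤ n := by exact_mod_cast hlt
      linarith
    rw [Int.fract_eq_iff]
    refine ⟨by positivity, (div_lt_one hnpos).mpr hlt', (((k + M) / n : ℕ) : ℤ) + ⌊v⌋, ?_⟩
    rw [Int.cast_add, Int.cast_natCast]
    have hinv : (n : ℚ) * (n : ℚ)⁻¹ = 1 := mul_inv_cancel₀ hnpos.ne'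
    linear_combination hvw + (n : ℚ)⁻¹ * hnw + (n : ℚ)⁻¹ * hkM +
      ((((k + M) / n : ℕ) : ℚ) - w) * hinv
  -- sum
  have hsum : ∑ k : Fin (m + 1), Int.fract (((k : ℕ) : ℚ) / ((m : ℚ) + 1) + v) =
      (∑ k : Fin (m + 1), (((((k : ℕ) + M) % n : ℕ) : ℚ))) / n + θ := by
    simp_rw [hterm, add_div, Finset.sum_add_distrib, Finset.sum_div, Finset.sum_const,
      Finset.card_univ, Fintype.card_fin, nsmul_eq_mul]
    rw [hn]; push_cast
    field_simp
  rw [hsum, sum_comp_add_mod_eq m M (fun k => ((k : ℕ) : ℚ)), sum_fin_natCast, hnq]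
  have hθv : θ = Int.fract ((n : ℚ) * v) := by
    have h1 : (n : ℚ) * w = n * v - (((n : ℤ) * ⌊v⌋ : ℤ) : ℚ) := by
      push_cast; linear_combination (-(n : ℚ)) * hvw
    rw [hθ, h1, Int.fract_sub_intCast]
  rw [hθv, hn]
  push_cast
  field_simp
  ring

/-! ## §1b The multiplication pair: admissibility and the Hodge test (`k = 0`) -/

/-- The box exponents `((i+1)/(m+1), s)` are admissible when `s > 0` is not an integer.
[folklore] -/
theorem admissible_multL (m : ℕ) {s : ℚ} (hs : 0 < s) (hsZ : Int.fract s ≠ 0) :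
    Admissible (fun i : Fin m => (((i : ℕ) : ℚ) + 1) / ((m : ℚ) + 1)) (fun _ => s) := by
  intro i
  refine ⟨by positivity, hs, ?_, hsZ⟩
  have h0 : (0 : ℚ) < (((i : ℕ) : ℚ) + 1) / ((m : ℚ) + 1) := by positivity
  have hle : ((i : ℕ) : ℚ) + 1 ≤ m := by exact_mod_cast Nat.succ_le_of_lt i.isLt
  have h1 : (((i : ℕ) : ℚ) + 1) / ((m : ℚ) + 1) < 1 := by
    rw [div_lt_one (by positivity)]; linarith
  simp only [ne_eq]
  rw [Int.fract_eq_self.mpr ⟨h0.le, h1⟩]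
  exact h0.ne'

/-- `k s` is not an integer for `0 < k < den s`. [folklore] -/
theorem fract_natCast_mul_ne_zero {s : ℚ} {k : ℕ} (hk : 0 < k) (hks : k < s.den) :
    Int.fract ((k : ℚ) * s) ≠ 0 := by
  intro h
  rw [Int.fract_eq_zero_iff] at h
  obtain ⟨z, hz⟩ := h
  have hk0 : (k : ℚ) ≠ 0 := by exact_mod_cast hk.ne'
  have hs' : s = (z : ℚ) / ((k : ℤ) : ℚ) := by
    rw [Int.cast_natCast, eq_div_iff hk0, mul_comm]; exact hz.symm
  have hdvd : (s.den : ℤ) ∣ (k : ℤ) := by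
    have h := Rat.den_dvd z k
    rwa [← Rat.intCast_div_eq_divInt, ← hs'] at h
  have hle : s.den ≤ k := Nat.le_of_dvd hk (by exact_mod_cast hdvd)
  omega

/-- The simplex-side exponents `(s, (j+1)s)` are admissible when `m < den s`. [folklore] -/
theorem admissible_multR (m : ℕ) {s : ℚ} (hs : 0 < s) (hden : m < s.den) :
    Admissible (fun _ : Fin m => s) (fun j : Fin m => (((j : ℕ) : ℚ) + 1) * s) := by
  intro j
  have hm : 1 ≤ m := j.pos
  refine ⟨hs, by positivity, ?_, ?_⟩
  · have h := fract_natCast_mul_ne_zero (s := s) (k := 1) one_pos (by omega)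
    simpa using h
  · have h := fract_natCast_mul_ne_zero (s := s) (k := (j : ℕ) + 1) (Nat.succ_pos _)
      (by have := j.isLt; omega)
    simpa using h

/-- **The multiplication pair is of Hodge type with `k = 0`**: for every `u ≥ 1` coprime to the
denominators, `Σ_{i<m} ({u(i+1)/n} + {us} − {u((i+1)/n + s)}) = Σ_{j<m} ({us} + {u(j+1)s} − {u(j+2)s})`
(`n = m + 1`): the right side telescopes to `(m+1){us} − {(m+1)us}`, and so does the left side
after re-indexing by the unit `u` of `ℤ/n` and Hermite's identity `sum_fract_div_add`.
[cite: Deligne1982HodgeCycles, §7 (restatement before Thm. 7.18)] -/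
theorem hodgeCondition_mult (m : ℕ) (s : ℚ) (hm : 1 ≤ m) :
    HodgeCondition m m 0 (fun i : Fin m => (((i : ℕ) : ℚ) + 1) / ((m : ℚ) + 1)) (fun _ => s)
      (fun _ : Fin m => s) (fun j : Fin m => (((j : ℕ) : ℚ) + 1) * s) := by
  intro u _ hcop _
  -- `u` is coprime to `m + 1 = den (1/(m+1))`
  have hcopn : Nat.Coprime u (m + 1) := by
    have h := (hcop ⟨0, hm⟩).1
    have hx0 : ((((⟨0, hm⟩ : Fin m) : ℕ) : ℚ) + 1) / ((m : ℚ) + 1) = (((m + 1 : ℕ) : ℚ))⁻¹ := by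
      push_cast; ring
    simp only at h
    rw [hx0, Rat.inv_natCast_den, if_neg (Nat.succ_ne_zero m)] at h
    exact h
  simp only [hodgeSum, Nat.cast_zero]
  set v : ℚ := (u : ℚ) * s with hv
  have hmq : (0 : ℚ) < (m : ℚ) + 1 := by positivity
  -- the left sum
  set g : ℕ → ℚ := fun k =>
    (k : ℚ) / ((m : ℚ) + 1) + Int.fract v - Int.fract ((k : ℚ) / ((m : ℚ) + 1) + v) with hg
  have hterm : ∀ i : Fin m,
      Int.fract ((u : ℚ) * ((((i : ℕ) : ℚ) + 1) / ((m : ℚ) + 1))) + Int.fract v -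
        Int.fract ((u : ℚ) * ((((i : ℕ) : ℚ) + 1) / ((m : ℚ) + 1) + s)) =
      g (u * ((i : ℕ) + 1) % (m + 1)) := by
    intro i
    have hux : (u : ℚ) * ((((i : ℕ) : ℚ) + 1) / ((m : ℚ) + 1)) =
        ((u * ((i : ℕ) + 1) : ℕ) : ℚ) / ((m + 1 : ℕ) : ℚ) := by push_cast; ring
    have hfr : Int.fract ((u : ℚ) * ((((i : ℕ) : ℚ) + 1) / ((m : ℚ) + 1))) =
        ((u * ((i : ℕ) + 1) % (m + 1) : ℕ) : ℚ) / ((m : ℚ) + 1) := by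
      rw [hux, Int.fract_div_natCast_eq_div_natCast_mod]; push_cast; ring
    rw [mul_add, ← hv, fract_add_eq_fract_fract_add (↑u * _) v, hfr]
  have hg0 : g 0 = 0 := by simp [hg]
  have hperm : ∑ i : Fin m, g (u * ((i : ℕ) + 1) % (m + 1)) = ∑ i : Fin m, g ((i : ℕ) + 1) := by
    have h1 : ∑ k : Fin (m + 1), g (u * (k : ℕ) % (m + 1)) =
        g 0 + ∑ i : Fin m, g (u * ((i : ℕ) + 1) % (m + 1)) := by
      rw [Fin.sum_univ_succ]; simp
    have h2 : ∑ k : Fin (m + 1), g (k : ℕ) = g 0 + ∑ i : Fin m, g ((i : ℕ) + 1) := by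
      rw [Fin.sum_univ_succ]; simp
    have h3 := sum_comp_mul_mod_eq m u hcopn g
    linarith
  have hgsum : ∑ i : Fin m, g ((i : ℕ) + 1) =
      ((m : ℚ) + 1) * Int.fract v - Int.fract (((m : ℚ) + 1) * v) := by
    have h2 : ∑ k : Fin (m + 1), g (k : ℕ) = g 0 + ∑ i : Fin m, g ((i : ℕ) + 1) := by
      rw [Fin.sum_univ_succ]; simp
    rw [hg0, zero_add] at h2
    rw [← h2]
    simp only [hg, Finset.sum_sub_distrib, Finset.sum_add_distrib, Finset.sum_const,
      Finset.card_univ, Fintype.card_fin, nsmul_eq_mul, ← Finset.sum_div]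
    rw [sum_fin_natCast, sum_fract_div_add]
    push_cast
    field_simp
    ring
  have hL : ∑ i : Fin m,
      (Int.fract ((u : ℚ) * ((((i : ℕ) : ℚ) + 1) / ((m : ℚ) + 1))) + Int.fract v -
        Int.fract ((u : ℚ) * ((((i : ℕ) : ℚ) + 1) / ((m : ℚ) + 1) + s))) =
      ((m : ℚ) + 1) * Int.fract v - Int.fract (((m : ℚ) + 1) * v) := by
    rw [Finset.sum_congr rfl fun i _ => hterm i, hperm, hgsum]
  -- the right sum telescopes
  set F : ℕ → ℚ := fun k => Int.fract (((k : ℚ) + 1) * v) with hF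
  have hR : ∑ j : Fin m,
      (Int.fract v + Int.fract ((u : ℚ) * ((((j : ℕ) : ℚ) + 1) * s)) -
        Int.fract ((u : ℚ) * (s + (((j : ℕ) : ℚ) + 1) * s))) =
      ((m : ℚ) + 1) * Int.fract v - Int.fract (((m : ℚ) + 1) * v) := by
    have hj : ∀ j : Fin m, Int.fract v + Int.fract ((u : ℚ) * ((((j : ℕ) : ℚ) + 1) * s)) -
        Int.fract ((u : ℚ) * (s + (((j : ℕ) : ℚ) + 1) * s)) = Int.fract v + (F j - F ((j : ℕ) + 1)) := by
      intro j
      simp only [hF]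
      rw [show (u : ℚ) * ((((j : ℕ) : ℚ) + 1) * s) = (((j : ℕ) : ℚ) + 1) * v by rw [hv]; ring,
        show (u : ℚ) * (s + (((j : ℕ) : ℚ) + 1) * s) = ((((j : ℕ) + 1 : ℕ) : ℚ) + 1) * v by
          rw [hv]; push_cast; ring]
      ring
    rw [Finset.sum_congr rfl fun j _ => hj j, Finset.sum_add_distrib, Finset.sum_const,
      Finset.card_univ, Fintype.card_fin, nsmul_eq_mul,
      Fin.sum_univ_eq_sum_range (fun j => F j - F (j + 1)) m, Finset.sum_range_sub']
    simp only [hF]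
    push_cast
    ring_nf
  rw [hL, hR, sub_self]

/-! ## §2 Gauss's multiplication formula in Beta form -/

/-- Telescoping product of ratios in a field: `∏_{j<m} f j / f (j+1) = f 0 / f m` when no `f j`
vanishes. [folklore] -/
theorem prod_range_div_succ {f : ℕ → ℝ} (hf : ∀ j, f j ≠ 0) :
    ∀ m : ℕ, ∏ j ∈ Finset.range m, f j / f (j + 1) = f 0 / f m
  | 0 => by simp [div_self (hf 0)]
  | m + 1 => by
    rw [Finset.prod_range_succ, prod_range_div_succ hf m]
    field_simp [hf m, hf (m + 1)]

/-- **Gauss's multiplication formula in Beta form** (the value identity of the multiplication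
pair): for `m ≥ 0`, `n = m + 1` and real `s > 0`,
`∏_{i<m} B((i+1)/n, s) = n^{ns−1} · ∏_{j<m} B(s, (j+1)s)` — both sides equal
`n^{ns−1} Γ(s)^n / Γ(ns)` (left: `∏_{k<n} Γ(s + k/n) = Γ(ns) √n (2π)^{(n−1)/2} n^{−ns}` and
`n ∏_{k<n} Γ((k+1)/n) = √n (2π)^{(n−1)/2}`, `GaussMultiplication.real_formula` / `const_eq`;
right: telescoping). [cite: AndrewsAskeyRoy1999, Thm 1.5.2] -/
theorem prod_beta_mult (m : ℕ) {s : ℝ} (hs : 0 < s) :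
    ∏ i : Fin m, ProbabilityTheory.beta ((((i : ℕ) : ℝ) + 1) / ((m : ℝ) + 1)) s =
      ((m : ℝ) + 1) ^ (((m : ℝ) + 1) * s - 1) *
        ∏ j : Fin m, ProbabilityTheory.beta s ((((j : ℕ) : ℝ) + 1) * s) := by
  set n : ℕ := m + 1 with hn
  have hn0 : n ≠ 0 := by omega
  have hnR : ((m : ℝ) + 1) = (n : ℝ) := by rw [hn]; push_cast; ring
  have hnpos : (0 : ℝ) < n := by rw [hn]; positivity
  rw [hnR]
  -- abbreviations
  set G : ℝ := Real.Gamma s with hG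
  have hGpos : 0 < G := Real.Gamma_pos_of_pos hs
  set C : ℝ := Real.sqrt n * (2 * Real.pi) ^ (((n : ℝ) - 1) / 2) with hC
  have hCpos : 0 < C := by positivity
  -- left numerator: `A = ∏ Γ((i+1)/n) = C / n`
  set A : ℝ := ∏ i : Fin m, Real.Gamma ((((i : ℕ) : ℝ) + 1) / n) with hA
  have hA_eq : (n : ℝ) * A = C := by
    have h := const_eq hn0
    have hP : prodGamma n (1 / n) = A * Real.Gamma 1 := by
      unfold prodGamma
      rw [hn, Finset.prod_range_succ, hA, Fin.prod_univ_eq_prod_range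
        (fun i => Real.Gamma (((i : ℝ) + 1) / ((m + 1 : ℕ) : ℝ))) m]
      congr 1
      · refine Finset.prod_congr rfl fun i _ => ?_
        congr 1; push_cast; ring
      · congr 1; push_cast; field_simp; ring
    rw [hP, Real.Gamma_one, mul_one] at h
    rw [h]
  -- left denominator: `B = ∏ Γ(s + (i+1)/n)`, `G * B * n^{ns} = Γ(ns) * C`
  set B : ℝ := ∏ i : Fin m, Real.Gamma ((((i : ℕ) : ℝ) + 1) / n + s) with hB
  have hBpos : 0 < B := Finset.prod_pos fun i _ => Real.Gamma_pos_of_pos (by positivity)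
  have hB_eq : G * B * (n : ℝ) ^ ((n : ℝ) * s) = Real.Gamma (n * s) * C := by
    have h := real_formula hn0 hs
    have hP : prodGamma n s = G * B := by
      unfold prodGamma
      rw [hn, Finset.prod_range_succ', hB, Fin.prod_univ_eq_prod_range
        (fun i => Real.Gamma (((i : ℝ) + 1) / ((m + 1 : ℕ) : ℝ) + s)) m]
      rw [mul_comm]
      congr 1
      · simp [hG]
      · refine Finset.prod_congr rfl fun i _ => ?_
        congr 1; push_cast; ring
    rw [hP] at h
    rw [h, hC]
    ring
  -- left side
  have hL : ∏ i : Fin m, ProbabilityTheory.beta ((((i : ℕ) : ℝ) + 1) / n) s = A * G ^ m / B := by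
    simp only [ProbabilityTheory.beta]
    rw [Finset.prod_div_distrib, Finset.prod_mul_distrib, Finset.prod_const, Finset.card_univ,
      Fintype.card_fin]
  -- right side: telescoping
  have hR : ∏ j : Fin m, ProbabilityTheory.beta s ((((j : ℕ) : ℝ) + 1) * s) =
      G ^ m * (G / Real.Gamma (n * s)) := by
    simp only [ProbabilityTheory.beta]
    have hre : ∀ j : Fin m, Real.Gamma s * Real.Gamma ((((j : ℕ) : ℝ) + 1) * s) /
        Real.Gamma (s + (((j : ℕ) : ℝ) + 1) * s) =
        G * (Real.Gamma ((((j : ℕ) : ℝ) + 1) * s) / Real.Gamma ((((j + 1 : ℕ) : ℝ) + 1) * s)) := by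
      intro j
      rw [hG, mul_div_assoc]
      congr 2; push_cast; ring
    rw [Finset.prod_congr rfl fun j _ => hre j, Finset.prod_mul_distrib, Finset.prod_const,
      Finset.card_univ, Fintype.card_fin,
      Fin.prod_univ_eq_prod_range (fun j => Real.Gamma (((j : ℝ) + 1) * s) /
        Real.Gamma ((((j + 1 : ℕ) : ℝ) + 1) * s)) m]
    have htel := prod_range_div_succ (f := fun j => Real.Gamma (((j : ℝ) + 1) * s))
      (fun j => (Real.Gamma_pos_of_pos (by positivity)).ne') m
    simp only [Nat.cast_add, Nat.cast_one] at htel ⊢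
    rw [htel, hG, hn]
    push_cast
    ring_nf
  rw [hL, hR]
  -- compare: `A G^m / B = n^{ns-1} G^m G / Γ(ns)`
  have hΓns : 0 < Real.Gamma (n * s) := Real.Gamma_pos_of_pos (by positivity)
  have hpow : (n : ℝ) ^ ((n : ℝ) * s - 1) * n = (n : ℝ) ^ ((n : ℝ) * s) := by
    rw [Real.rpow_sub_one hnpos.ne']; field_simp
  have hA' : A = C / n := by rw [← hA_eq]; field_simp
  have hΓ0 : Real.Gamma (n * s) ≠ 0 := hΓns.ne'
  have hC' : C = G * B * (n : ℝ) ^ ((n : ℝ) * s) / Real.Gamma (n * s) := by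
    rw [hB_eq]; field_simp
  have hB0 : B ≠ 0 := hBpos.ne'
  have hn0' : (n : ℝ) ≠ 0 := hnpos.ne'
  rw [hA', hC', ← hpow]
  field_simp

end Summit.KontsevichZagierPeriods.GammaHodgeSectorKO

end
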